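import Mathlib
import HarnessLib
import Literature.Analysis.FluidPDE.VorticityCalculus
import Summits.NavierStokesRegularity.NavierStokesRegularity.Theorems.PoloidalWindowDoorPoloidalWindowRigidityFluxTransport
import Summits.NavierStokesRegularity.NavierStokesRegularity.Theorems.PoloidalWindowDoorPoloidalWindowRigidityZeroModeHeat
import Summits.NavierStokesRegularity.NavierStokesRegularity.Theorems.PoloidalWindowDoorPoloidalWindowRigidityZeroModeOseen

/-!
# Route `PoloidalWindowDoor`, crux `PoloidalWindowRigidity` (stmt-NavierStokesRegularity-19708) — LINE 16 «zero_mode» (ns-idea-8, v1.1–v1.3): the KERNEL in the tree —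
# the ZERO-MODE LAW `Z`, «NO HOT PLANE», and hot_split's cell C1 `stub_cellC1` (VERBATIM), all UNCONDITIONAL over the landed stubs Z-heat / Z-oseen / F

Cell ns-regularity-ideate, seat ns-poloidal-K2-p2 g13 (K2 hand).  The line file `Cruxes/PoloidalWindowRigidity/Lines/zero_mode.lean` composes its three provable
stubs into cell C1 of `Lines/hot_split.lean` by a sorry-free kernel; the stubs are tree theorems (`…ZeroModeHeat.stub_zeroModeHeat` p681062,
`…ZeroModeOseen.stub_zeroModeOseen` p684523, `…FluxTransport.stub_fluxTransport` p680813), and this file re-assembles the kernel at Theorems level so that the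
three conclusions are importable BY NAME:

* `zeroModeLaw` = `ZeroMode.ZeroModeLaw` VERBATIM (flatBox unfolded): every class profile has flat-box means of `v₂(t)` that are `≤ ε|Q|` on large boxes
  (the line's 10-line assembly: past time `s = t − 1 − (2C/ε)²` makes the heat part `≤ ε/2`, then `L₀(s,t,ε/2)` from Z-oseen);
* `noHotPlane` = `ZeroMode.NoHotPlane` VERBATIM: in the class, a plane on which the normal velocity is constant at one time carries the value `0`
  (the line's real-arithmetic kernel: `ε = |N|/4`, `H = L₀`, `R = max L₀ (|M|L₀/|N|)`);
* `hotSplit_cellC1` = hot_split v1.2/v1.3 `stub_cellC1` VERBATIM with the Cruxes-local packages `Pinned` / `ThickWindow` / `Peakless` unfolded (as A1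
  `…HotPlaneConst.stub_hotPlaneConst`, p677063, unfolds `Pinned`): a pinned profile whose time-`−1` slice is constant on the hot-spot plane does not exist.

Proof scripts adapted verbatim from the line file (ns-idea-8 g8).  HONEST LABEL: cell C1 only; HL3′ = C1 ∧ C2a ∧ C2b has the RIDGE cells C2a, C2b OPEN, and the
column's residue is C2a ∧ C2b ∧ S0 ∧ ⟨27893⟩; 19708 / 20428 OPEN; no claim about Navier–Stokes regularity.
-/

noncomputable section

-- the summit and its single sub-problem share the name (CONVENTIONS §1), as in every Theorems file
set_option linter.dupNamespace false

namespace Summit.NavierStokesRegularity.NavierStokesRegularity.Theorems.PoloidalWindowDoorPoloidalWindowRigidityZeroModeNoHotPlane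

open MeasureTheory Set Function
open scoped RealInnerProductSpace InnerProductSpace Laplacian
open Literature.Analysis Literature.Analysis.FluidPDE Literature.Analysis.UnboundedOperators
open Summit.NavierStokesRegularity.NavierStokesRegularity.Theorems.PoloidalWindowDoorPoloidalWindowRigidityFluxTransport
open Summit.NavierStokesRegularity.NavierStokesRegularity.Theorems.PoloidalWindowDoorPoloidalWindowRigidityZeroModeHeat
open Summit.NavierStokesRegularity.NavierStokesRegularity.Theorems.PoloidalWindowDoorPoloidalWindowRigidityZeroModeOseen

/-- **Z — the zero-mode law** (`ZeroMode.ZeroModeLaw` VERBATIM, flatBox unfolded), UNCONDITIONAL: `Z ⇐ Z-heat ∧ Z-oseen` in the ORDER of price P16-2 (past time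
first, then the box size). -/
theorem zeroModeLaw :
    ∀ (C : ℝ) (v : ℝ → EuclideanSpace ℝ (Fin 3) → EuclideanSpace ℝ (Fin 3)),
    Literature.Analysis.FluidPDE.HasTypeITimeDecay C v →
    ContinuousOn (Function.uncurry v) (Set.Iio (0 : ℝ) ×ˢ Set.univ) →
    (∀ s t : ℝ, s < t → t < 0 → ∀ x, v t x =
      Literature.Analysis.UnboundedOperators.heatExtension (v s) (t - s) x -
        Literature.Analysis.FluidPDE.oseenDuhamel 1 s v v t x) →
    ∀ t : ℝ, t < 0 → ∀ ε : ℝ, 0 < ε → ∃ L₀ : ℝ, 0 < L₀ ∧ ∀ R H : ℝ, L₀ ≤ R → L₀ ≤ H →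
      |∫ x in {x : EuclideanSpace ℝ (Fin 3) | |x 0| ≤ R ∧ |x 1| ≤ R ∧ 0 ≤ x 2 ∧ x 2 ≤ H}, v t x 2| ≤ ε * (4 * R ^ 2 * H) := by
  intro C v hT hc hm t ht ε hε
  set s : ℝ := t - 1 - (2 * C / ε) ^ 2 with hs_def
  have hsq0 : 0 ≤ (2 * C / ε) ^ 2 := sq_nonneg _
  have hst : s < t := by rw [hs_def]; linarith
  have hs0 : 0 < -s := by rw [hs_def]; linarith
  have hspos : 0 < Real.sqrt (-s) := Real.sqrt_pos.2 hs0
  -- the past time `s` makes the heat part `≤ ε/2`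
  have hCs : C / Real.sqrt (-s) ≤ ε / 2 := by
    have h1 : Real.sqrt ((2 * C / ε) ^ 2) ≤ Real.sqrt (-s) :=
      Real.sqrt_le_sqrt (by rw [hs_def]; linarith)
    rw [Real.sqrt_sq_eq_abs] at h1
    have h2 : |2 * C / ε| = 2 * |C| / ε := by
      rw [abs_div, abs_mul, abs_of_pos hε, abs_of_pos (by norm_num : (0:ℝ) < 2)]
    rw [h2] at h1
    have h3 : 2 * |C| ≤ ε * Real.sqrt (-s) := by
      have := (div_le_iff₀ hε).1 h1
      linarith [this]
    have h4 : C ≤ |C| := le_abs_self C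
    rw [div_le_iff₀ hspos]
    nlinarith [h3, h4, hspos.le]
  obtain ⟨L₀, hL₀, hL⟩ := stub_zeroModeOseen C v hT hc hm s t hst ht (ε / 2) (by positivity)
  refine ⟨L₀, hL₀, fun R H hR hH' => ?_⟩
  have hRpos : 0 < R := hL₀.trans_le hR
  have hHpos : 0 < H := hL₀.trans_le hH'
  have hvol : 0 < 4 * R ^ 2 * H := by positivity
  have h1 := stub_zeroModeHeat C v hT s t hst ht R H hRpos hHpos
  have h2 := hL R H hR hH'
  have h3 : C / Real.sqrt (-s) * (4 * R ^ 2 * H) ≤ ε / 2 * (4 * R ^ 2 * H) :=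
    mul_le_mul_of_nonneg_right hCs hvol.le
  linarith

/-- **No hot plane** (`ZeroMode.NoHotPlane` VERBATIM), UNCONDITIONAL: in the class, a plane on which the normal velocity is constant at one time carries the
value `0` (`Z` + flux transport F `…FluxTransport.stub_fluxTransport`; the line's kernel `noHotPlane_of_zeroMode_of_flux`). -/
theorem noHotPlane :
    ∀ (C : ℝ) (v : ℝ → EuclideanSpace ℝ (Fin 3) → EuclideanSpace ℝ (Fin 3)),
    Literature.Analysis.FluidPDE.HasTypeITimeDecay C v →
    ContinuousOn (Function.uncurry v) (Set.Iio (0 : ℝ) ×ˢ Set.univ) →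
    (∀ s t : ℝ, s < t → t < 0 → ∀ x, v t x =
      Literature.Analysis.UnboundedOperators.heatExtension (v s) (t - s) x -
        Literature.Analysis.FluidPDE.oseenDuhamel 1 s v v t x) →
    (∀ t < 0, Literature.Analysis.FluidPDE.VectorCalculus.IsDivFree (v t)) →
    ∀ t : ℝ, t < 0 → (∀ y : EuclideanSpace ℝ (Fin 3), y 2 = 0 → v t y 2 = v t 0 2) → v t 0 2 = 0 := by
  intro C v hrate hcont hmild hdiv t ht hplane
  by_contra hN
  have hNpos : 0 < |v t 0 2| := abs_pos.mpr hN
  obtain ⟨L₀, hL₀, hZ'⟩ := zeroModeLaw C v hrate hcont hmild t ht (|v t 0 2| / 4) (by positivity)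
  obtain ⟨M, hM⟩ := stub_fluxTransport C v hrate hcont hmild hdiv t ht hplane
  -- the box: height `H = L₀`, half-width `R = max L₀ (|M| L₀ / |N|)`
  set N : ℝ := v t 0 2 with hNdef
  set R : ℝ := max L₀ (|M| * L₀ / |N|) with hRdef
  have hR₁ : L₀ ≤ R := le_max_left _ _
  have hR₂ : |M| * L₀ / |N| ≤ R := le_max_right _ _
  have hRpos : 0 < R := lt_of_lt_of_le hL₀ hR₁
  have h₁ := hZ' R L₀ hR₁ le_rfl
  have h₂ := hM R L₀ hRpos hL₀
  set I : ℝ := ∫ x in {x : EuclideanSpace ℝ (Fin 3) | |x 0| ≤ R ∧ |x 1| ≤ R ∧ 0 ≤ x 2 ∧ x 2 ≤ L₀}, v t x 2 with hIdef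
  have hML : |M| * L₀ ≤ |N| * R := by
    have h := (div_le_iff₀ hNpos).mp hR₂
    linarith [h]
  have h₃ : M * R * L₀ ^ 2 ≤ |N| * R ^ 2 * L₀ := by
    calc M * R * L₀ ^ 2 ≤ |M| * R * L₀ ^ 2 := by gcongr; exact le_abs_self M
      _ = (|M| * L₀) * (R * L₀) := by ring
      _ ≤ (|N| * R) * (R * L₀) := by gcongr
      _ = |N| * R ^ 2 * L₀ := by ring
  have h₄ : |N * (4 * R ^ 2 * L₀)| ≤ |I| + |I - N * (4 * R ^ 2 * L₀)| := by
    calc |N * (4 * R ^ 2 * L₀)| = |I - (I - N * (4 * R ^ 2 * L₀))| := by congr 1; ring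
      _ ≤ |I| + |I - N * (4 * R ^ 2 * L₀)| := abs_sub _ _
  have h₅ : |N * (4 * R ^ 2 * L₀)| = |N| * (4 * R ^ 2 * L₀) := by
    rw [abs_mul, abs_of_pos (by positivity : (0 : ℝ) < 4 * R ^ 2 * L₀)]
  have hK : 0 < |N| * (R ^ 2 * L₀) := by positivity
  nlinarith [h₁, h₂, h₃, h₄, h₅, hK]

/-- **hot_split's cell C1 `stub_cellC1` (VERBATIM, with `Pinned` / `ThickWindow` / `Peakless` unfolded), UNCONDITIONAL**: a pinned, thick, peakless class
profile whose time-`−1` slice is constant on the hot-spot plane `{y 2 = 0}` does not exist — `N = v₂(−1,0) ≠ 0` is part of `Pinned`, and `noHotPlane` forces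
`N = 0`.  Neither the window nor peaklessness nor poloidality is used. -/
theorem hotSplit_cellC1 :
    ∀ (C : ℝ) (v : ℝ → EuclideanSpace ℝ (Fin 3) → EuclideanSpace ℝ (Fin 3)) (W : Set (ℝ × EuclideanSpace ℝ (Fin 3))),
      (Literature.Analysis.FluidPDE.HasTypeITimeDecay C v ∧
        ContinuousOn (Function.uncurry v) (Set.Iio (0 : ℝ) ×ˢ Set.univ) ∧
        (∀ s t : ℝ, s < t → t < 0 → ∀ x, v t x =
          Literature.Analysis.UnboundedOperators.heatExtension (v s) (t - s) x -
            Literature.Analysis.FluidPDE.oseenDuhamel 1 s v v t x) ∧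
        (∀ t < 0, Literature.Analysis.FluidPDE.VectorCalculus.IsDivFree (v t)) ∧
        (∀ s < 0, ∀ y, ⟪Literature.Analysis.FluidPDE.curl (v s) y, EuclideanSpace.single 2 1⟫_ℝ = 0) ∧
        v (-1) 0 2 ≠ 0 ∧ (∀ t < 0, ∀ x, Real.sqrt (-t) * |v t x 2| ≤ |v (-1) 0 2|) ∧
        (∀ h : EuclideanSpace ℝ (Fin 3), fderiv ℝ (v (-1)) 0 h 2 = 0) ∧
        (deriv (fun s => v s 0 2) (-1) = v (-1) 0 2 / 2 ∧ v (-1) 0 2 * (Δ (fun y => v (-1) y 2)) 0 ≤ 0)) →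
      (IsOpen W ∧ W ⊆ Set.Iio (0 : ℝ) ×ˢ Set.univ ∧
        (∀ z ∈ W, (Literature.Analysis.FluidPDE.curl (v z.1) z.2 ≠ 0 ∧
            (fderiv ℝ (v z.1) z.2 (EuclideanSpace.single 0 1) 2 ≠ 0 ∨ fderiv ℝ (v z.1) z.2 (EuclideanSpace.single 1 1) 2 ≠ 0) ∧
            (fderiv ℝ (v z.1) z.2 (EuclideanSpace.single 2 1) 0 ≠ 0 ∨ fderiv ℝ (v z.1) z.2 (EuclideanSpace.single 2 1) 1 ≠ 0)) ∧
          (fderiv ℝ (fun x => fderiv ℝ (v z.1) x (EuclideanSpace.single 2 1) 2) z.2 (EuclideanSpace.single 0 1) *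
                fderiv ℝ (v z.1) z.2 (EuclideanSpace.single 1 1) 2 -
              fderiv ℝ (fun x => fderiv ℝ (v z.1) x (EuclideanSpace.single 2 1) 2) z.2 (EuclideanSpace.single 1 1) *
                fderiv ℝ (v z.1) z.2 (EuclideanSpace.single 0 1) 2 ≠ 0)) ∧
        (∀ m : ℝ → ℝ → ℝ, ∀ W₁ : Set (ℝ × EuclideanSpace ℝ (Fin 3)), W₁ ⊆ W → IsOpen W₁ → W₁.Nonempty →
            ∃ z ∈ W₁, ∃ b : Fin 3, b ≠ 2 ∧
              fderiv ℝ (v z.1) z.2 (EuclideanSpace.single 2 1) b ≠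
                m z.1 (z.2 2) * fderiv ℝ (v z.1) z.2 (EuclideanSpace.single b 1) 2) ∧
        (∀ r : ℝ, 0 < r → (Metric.ball ((-1 : ℝ), (0 : EuclideanSpace ℝ (Fin 3))) r ∩ W).Nonempty)) →
      (∀ (s z₀ σ M : ℝ) (K O : Set (EuclideanSpace ℝ (Fin 3))), s < 0 →
        ((σ = 1 ∨ σ = -1) ∧ IsCompact K ∧ K.Nonempty ∧ (∀ y ∈ K, y 2 = z₀ ∧ σ * v s y 2 = M) ∧
          IsOpen O ∧ K ⊆ O ∧ (∀ y ∈ O, y 2 = z₀ → σ * v s y 2 ≤ M) ∧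
          (∀ y ∈ O, y 2 = z₀ → σ * v s y 2 = M → y ∈ K)) → False) →
      (∀ y : EuclideanSpace ℝ (Fin 3), y 2 = 0 →
        v (-1) y = v (-1) 0 ∧ fderiv ℝ (fun x => v (-1) x 2) y (EuclideanSpace.single 2 1) = 0) →
      False := by
  intro C v W hP _hT _hK hplane
  obtain ⟨hrate, hcont, hmild, hdiv, -, hV, -⟩ := hP
  have hconst : ∀ y : EuclideanSpace ℝ (Fin 3), y 2 = 0 → v (-1) y 2 = v (-1) 0 2 := fun y hy => by
    rw [(hplane y hy).1]
  exact hV (noHotPlane C v hrate hcont hmild hdiv (-1) (by norm_num) hconst)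

end Summit.NavierStokesRegularity.NavierStokesRegularity.Theorems.PoloidalWindowDoorPoloidalWindowRigidityZeroModeNoHotPlane

end
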